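import Summits.QuantumFields.YangMills.Theorems.UnitScaleTiltProp7BoxChartTransport
import HarnessLib

/-!
# Route `UnitScaleTilt`, crux K1 «MinimiserStabilityRegPr» (stmt-QuantumFields-19200) — route-R E′ (A′), LANE II «DIVERGENCE RECOVERY AT CURVED `W`» (★★OWNER RULING №23),
# (B7) [I-5] (a′) «THE MEMBER READING OF (B9d)», FILE 1∕2 — THE THREE TRANSPORT ROWS: **for a gauge parameter `φ` supported in a box chart `transl c (box z R)` with chart values
# `(toL2S)⁻¹ φ (transl c w) = η • φZ w` (px12's (B8-member) rows VERBATIM) and any `S ⊆ box z R`: (A) the member mass of `φ` on the chart image of `S` IS `c₀η²·Σ_S hs(φZ)`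
# `≤ 2c₀η²·Σ_S‖φZ‖²`; (B) the `ℤ³` covariant-difference sum of `φZ` over the bonds of `S` (px4's (B9d) COV term) is `≤ c₀⁻¹·‖D_W φ‖²`; (C) `c₀η²·Σ_S‖φZ‖² ≤ ‖φ‖²`** — the
# member-side half of reading px4's `sum_tiled_sq_le_plaq` ((B9d), `ℤᵈ`, axial block means) at the member: its LHS and its two fine-scale terms become `Φt_c`, `‖D_Wφ_c‖²`, `‖φ_c‖²`,
# while its two coarse terms stay on the `ℤ³` side for the conversion row [I-5-conv] (★p1 g19 LANE II NAMER WORD №13 [I-5], 2026-08-29).  FILE 2∕2 (the knit with (B9d)) follows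
# (B9d)'s landing.

Cell `ym3-torus` ∕ width seat `ym3-torus-px9` (gen 7, «width 9»).  THEOREMS ONLY (0 `def`, 0 `sorry`); `--supports stmt-QuantumFields-19200 --as helper`, count-neutral.
YM₃ on T³ is a ladder rung (R3), not d = 4, not the Clay problem; nothing here claims (B9d), (B8), (B7), the divergence-recovery row (REC), `hN06`, E′, EX or the gap.

LETTERS (all from ✓p709960 `Prop7BoxChartTransport` ∕ ✓`Prop7SectET3HilbertLetters`): chart `transl c : Zd 3 → Site (F.P K) 0`, `box z R`, injective on the box when
`2R + 1 ≤ N₀` (`transl_injOn_box`); `toL2S`∕`toL2` the `L²` coordinates (`‖toL2S l‖² = c₀·Σ_x hs(l x)`, `‖toL2 X‖² = c₀·Σ_b ‖frob⁻¹(X b)‖²`), `hs X = Σ_{jk}‖X j k‖²`,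
`‖X‖_op² ≤ hs X ≤ 2‖X‖_op²` (✓`norm_le_norm_frobEquiv_symm`, ✓`sum_norm_sq_le_two_mul_opNorm_sq`); `η = eta F n K`.

WHAT IS PROVED (ns `…Theorems.Prop7TiledCubeMemberRows`; `F n K c₀`, any `W`, chart data `c z R`, `S ⊆ box z R`):
* `hs_smul_real` (`hs(η•X) = η²·hs X`), ★ `chart_mass_eq` (A, exact), ★ `chart_mass_le` (A: `≤ 2c₀η²Σ_S‖φZ‖²`), ★★ `chart_mass_le_norm_sq` (C: `c₀η²Σ_S hs(φZ) ≤ ‖φ‖²`),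
  `eta_sq_sum_opNorm_sq_le_norm_sq` (C, op-norm form), ★★★ `cov_sum_le_norm_DL2_sq` (B: `c₀·Σ_{w∈S}Σ_μ[w+e_μ∈S]‖Ad(V w μ)φZ(w+e_μ) − φZ w‖² ≤ ‖DL2 W φ‖²`, from the
  gradient row `hD` of (B8-member)).
HONEST SCOPE.  `Finset` bookkeeping over landed identities; nothing of (B9d)∕(B8)∕(B7)∕(REC)∕`hN06`∕the crux is asserted; rung R3, not Clay; YM gap NOT proved.

References: T. Bałaban, CMP 99 (1985) 389–434 [Balaban1985BackgroundPropagators] ((3.3) p.391, (3.11) p.392, (3.23) p.394); T. Bałaban, CMP 98 (1985) 17–51 [Balaban1985Averaging]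
(pp.24–25); [folklore].
-/

set_option autoImplicit false

noncomputable section

open scoped BigOperators Matrix.Norms.L2Operator InnerProductSpace
open Finset

namespace Summit.QuantumFields.YangMills.Theorems.Prop7TiledCubeMemberRows

open Literature.MathematicalPhysics.QuantumFieldTheory.Balaban1983to89
open Literature.MathematicalPhysics.QuantumFieldTheory.Balaban1983to89.T3ContinuumYM3Torus
open Literature.MathematicalPhysics.QuantumFieldTheory.Balaban1983to89.B4Eq19LatticeOperators (Zd box unitVec)
open B10Eq27TorusAxialLog (transl)
open B10StarCount (sum_pbond)
open B7Eq78Linearization (conjR)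
open T3SectALandauChart (eta eta_pos)
open B11Eq103H1Complex (SiteL2K BondL2K)
open Summit.QuantumFields.YangMills.Theorems.Prop7SectET3Transport (periodsT3)
open Summit.QuantumFields.YangMills.Theorems.Prop7SectET3HilbertLetters (W₂ frobEquiv toL2 toL2S DL2)
open Summit.QuantumFields.YangMills.Theorems.Prop7DeltaEtaAlmostPositive (norm_toL2_sq)
open Summit.QuantumFields.YangMills.Theorems.Prop7LaplaceAFlatLetters (norm_sq_toL2S)
open Summit.QuantumFields.YangMills.Theorems.Prop7RieszTauFrobNorm (norm_sq_frobEquiv_symm sum_norm_sq_le_two_mul_opNorm_sq norm_le_norm_frobEquiv_symm)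
open Summit.QuantumFields.YangMills.Theorems.Prop7BoxChartTransport (transl_injOn_box)

variable (F : T3Family) (n K : ℕ) (c₀ : ℝ) [Fact (0 < c₀)]

/-- Entrywise: `hs(η • X) = η²·hs(X)` for a real scalar. [folklore] -/
theorem hs_smul_real (η : ℝ) (X : Matrix (Fin 2) (Fin 2) ℂ) :
    ∑ j : Fin 2, ∑ k : Fin 2, ‖(η • X) j k‖ ^ 2 = η ^ 2 * ∑ j : Fin 2, ∑ k : Fin 2, ‖X j k‖ ^ 2 := by
  rw [Finset.mul_sum]
  refine Finset.sum_congr rfl fun j _ => ?_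
  rw [Finset.mul_sum]
  refine Finset.sum_congr rfl fun k _ => ?_
  rw [Matrix.smul_apply, norm_smul, Real.norm_eq_abs, mul_pow, sq_abs]

omit [Fact (0 < c₀)] in
/-- ★ (A, exact) **THE MEMBER MASS ON A CHART SUBSET**: `c₀·Σ_{w∈S} hs((toL2S)⁻¹φ (transl c w)) = c₀η²·Σ_{w∈S} hs(φZ w)` for `S ⊆ box z R`.
[cite: Balaban1985BackgroundPropagators, (3.11) p.392] -/
theorem chart_mass_eq (c : Site (F.P K) 0) {z : Zd (F.P K).d} {R : ℤ} (φ : SiteL2K ℂ 3 (periodsT3 F K) c₀ W₂) (φZ : Zd (F.P K).d → Matrix (Fin 2) (Fin 2) ℂ)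
    (hφZ : ∀ w ∈ box z R, (toL2S F K c₀).symm φ (transl c w) = (eta F n K) • φZ w) (S : Finset (Zd (F.P K).d)) (hS : S ⊆ box z R) :
    c₀ * ∑ w ∈ S, ∑ j : Fin 2, ∑ k : Fin 2, ‖((toL2S F K c₀).symm φ (transl c w)) j k‖ ^ 2
      = c₀ * (eta F n K) ^ 2 * ∑ w ∈ S, ∑ j : Fin 2, ∑ k : Fin 2, ‖(φZ w) j k‖ ^ 2 := by
  have h : ∑ w ∈ S, ∑ j : Fin 2, ∑ k : Fin 2, ‖((toL2S F K c₀).symm φ (transl c w)) j k‖ ^ 2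
      = (eta F n K) ^ 2 * ∑ w ∈ S, ∑ j : Fin 2, ∑ k : Fin 2, ‖(φZ w) j k‖ ^ 2 := by
    rw [Finset.mul_sum]
    exact Finset.sum_congr rfl fun w hw => by rw [hφZ w (hS hw), hs_smul_real]
  rw [h, mul_assoc]

/-- ★ (A) `c₀·Σ_{w∈S} hs((toL2S)⁻¹φ (transl c w)) ≤ 2·c₀η²·Σ_{w∈S} ‖φZ w‖²` (operator norm on the right). [folklore] -/
theorem chart_mass_le (c : Site (F.P K) 0) {z : Zd (F.P K).d} {R : ℤ} (φ : SiteL2K ℂ 3 (periodsT3 F K) c₀ W₂) (φZ : Zd (F.P K).d → Matrix (Fin 2) (Fin 2) ℂ)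
    (hφZ : ∀ w ∈ box z R, (toL2S F K c₀).symm φ (transl c w) = (eta F n K) • φZ w) (S : Finset (Zd (F.P K).d)) (hS : S ⊆ box z R) :
    c₀ * ∑ w ∈ S, ∑ j : Fin 2, ∑ k : Fin 2, ‖((toL2S F K c₀).symm φ (transl c w)) j k‖ ^ 2
      ≤ 2 * (c₀ * (eta F n K) ^ 2) * ∑ w ∈ S, ‖φZ w‖ ^ 2 := by
  have hc : 0 < c₀ := Fact.out
  rw [chart_mass_eq F n K c₀ c φ φZ hφZ S hS]
  have h : ∑ w ∈ S, ∑ j : Fin 2, ∑ k : Fin 2, ‖(φZ w) j k‖ ^ 2 ≤ 2 * ∑ w ∈ S, ‖φZ w‖ ^ 2 := by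
    rw [Finset.mul_sum]
    exact Finset.sum_le_sum fun w _ => sum_norm_sq_le_two_mul_opNorm_sq (φZ w)
  calc c₀ * (eta F n K) ^ 2 * ∑ w ∈ S, ∑ j : Fin 2, ∑ k : Fin 2, ‖(φZ w) j k‖ ^ 2
      ≤ c₀ * (eta F n K) ^ 2 * (2 * ∑ w ∈ S, ‖φZ w‖ ^ 2) := mul_le_mul_of_nonneg_left h (by positivity)
    _ = 2 * (c₀ * (eta F n K) ^ 2) * ∑ w ∈ S, ‖φZ w‖ ^ 2 := by ring

/-- ★★ (C) **THE CHART MASS IS BELOW THE TOTAL MASS**: `c₀η²·Σ_{w∈S} hs(φZ w) ≤ ‖φ‖²` (`S ⊆ box z R`, the chart injective on the box).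
[cite: Balaban1985BackgroundPropagators, (3.11) p.392] -/
theorem chart_mass_le_norm_sq (c : Site (F.P K) 0) {z : Zd (F.P K).d} {R : ℤ} (hRN : 2 * R + 1 ≤ ((F.P K).sitesPerDir 0 : ℤ))
    (φ : SiteL2K ℂ 3 (periodsT3 F K) c₀ W₂) (φZ : Zd (F.P K).d → Matrix (Fin 2) (Fin 2) ℂ)
    (hφZ : ∀ w ∈ box z R, (toL2S F K c₀).symm φ (transl c w) = (eta F n K) • φZ w) (S : Finset (Zd (F.P K).d)) (hS : S ⊆ box z R) :
    c₀ * (eta F n K) ^ 2 * ∑ w ∈ S, ∑ j : Fin 2, ∑ k : Fin 2, ‖(φZ w) j k‖ ^ 2 ≤ ‖φ‖ ^ 2 := by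
  classical
  have hc : 0 < c₀ := Fact.out
  rw [← chart_mass_eq F n K c₀ c φ φZ hφZ S hS]
  have hφ : ‖φ‖ ^ 2 = ‖toL2S F K c₀ ((toL2S F K c₀).symm φ)‖ ^ 2 := by rw [LinearEquiv.apply_symm_apply]
  rw [hφ, norm_sq_toL2S]
  refine mul_le_mul_of_nonneg_left ?_ hc.le
  have hinj : Set.InjOn (transl c) (↑S : Set (Zd (F.P K).d)) := (transl_injOn_box c hRN).mono (by exact_mod_cast hS)
  have himg := Finset.sum_image (f := fun x : Site (F.P K) 0 => ∑ j : Fin 2, ∑ k : Fin 2, ‖((toL2S F K c₀).symm φ x) j k‖ ^ 2) hinj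
  rw [← himg]
  exact Finset.sum_le_sum_of_subset_of_nonneg (Finset.subset_univ _) fun x _ _ => by positivity

/-- (C) in operator norm: `c₀η²·Σ_{w∈S}‖φZ w‖² ≤ ‖φ‖²`. [folklore] -/
theorem eta_sq_sum_opNorm_sq_le_norm_sq (c : Site (F.P K) 0) {z : Zd (F.P K).d} {R : ℤ} (hRN : 2 * R + 1 ≤ ((F.P K).sitesPerDir 0 : ℤ))
    (φ : SiteL2K ℂ 3 (periodsT3 F K) c₀ W₂) (φZ : Zd (F.P K).d → Matrix (Fin 2) (Fin 2) ℂ)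
    (hφZ : ∀ w ∈ box z R, (toL2S F K c₀).symm φ (transl c w) = (eta F n K) • φZ w) (S : Finset (Zd (F.P K).d)) (hS : S ⊆ box z R) :
    c₀ * (eta F n K) ^ 2 * ∑ w ∈ S, ‖φZ w‖ ^ 2 ≤ ‖φ‖ ^ 2 := by
  refine le_trans ?_ (chart_mass_le_norm_sq F n K c₀ c hRN φ φZ hφZ S hS)
  have hc : 0 < c₀ := Fact.out
  refine mul_le_mul_of_nonneg_left (Finset.sum_le_sum fun w _ => ?_) (by positivity)
  have h := norm_le_norm_frobEquiv_symm (φZ w)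
  rw [← norm_sq_frobEquiv_symm]
  exact pow_le_pow_left₀ (norm_nonneg _) h 2

/-- ★★★ (B) **THE COVARIANT-DIFFERENCE SUM OF THE CHART FIELD IS BELOW THE MEMBER GRADIENT**: from the gradient row of the chart
(`(toL2)⁻¹(D_W φ)⟨transl c w, μ⟩ = Ad(V w μ)φZ(w + e_μ) − φZ w` on the inside bonds of the box), for every `S ⊆ box z R`:
`c₀·Σ_{w∈S}Σ_μ [w + e_μ ∈ S]·‖Ad(V w μ)φZ(w+e_μ) − φZ w‖² ≤ ‖D_W φ‖²`. [cite: Balaban1985BackgroundPropagators, (3.3) p.391, (3.11) p.392] -/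
theorem cov_sum_le_norm_DL2_sq (W : GaugeField (F.P K) 0 (Matrix.specialUnitaryGroup (Fin 2) ℂ))
    (c : Site (F.P K) 0) {z : Zd (F.P K).d} {R : ℤ} (hRN : 2 * R + 1 ≤ ((F.P K).sitesPerDir 0 : ℤ))
    (V : Zd (F.P K).d → Fin (F.P K).d → (Matrix (Fin 2) (Fin 2) ℂ)ˣ)
    (φ : SiteL2K ℂ 3 (periodsT3 F K) c₀ W₂) (φZ : Zd (F.P K).d → Matrix (Fin 2) (Fin 2) ℂ)
    (hD : ∀ w ∈ box z R, ∀ μ, w + unitVec μ ∈ box z R →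
      (toL2 F K c₀).symm (DL2 F n K c₀ W φ) ⟨transl c w, μ⟩ = conjR (V w μ) (φZ (w + unitVec μ)) - φZ w)
    (S : Finset (Zd (F.P K).d)) (hS : S ⊆ box z R) :
    c₀ * ∑ w ∈ S, ∑ μ : Fin (F.P K).d, (if w + unitVec μ ∈ S then ‖conjR (V w μ) (φZ (w + unitVec μ)) - φZ w‖ ^ 2 else 0)
      ≤ ‖DL2 F n K c₀ W φ‖ ^ 2 := by
  classical
  have hc : 0 < c₀ := Fact.out
  set X := (toL2 F K c₀).symm (DL2 F n K c₀ W φ) with hX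
  have hDX : ‖DL2 F n K c₀ W φ‖ ^ 2 = ‖toL2 F K c₀ X‖ ^ 2 := by rw [hX, LinearEquiv.apply_symm_apply]
  rw [hDX, norm_toL2_sq, sum_pbond]
  refine mul_le_mul_of_nonneg_left ?_ hc.le
  have hinj : Set.InjOn (transl c) (↑S : Set (Zd (F.P K).d)) := (transl_injOn_box c hRN).mono (by exact_mod_cast hS)
  calc ∑ w ∈ S, ∑ μ : Fin (F.P K).d, (if w + unitVec μ ∈ S then ‖conjR (V w μ) (φZ (w + unitVec μ)) - φZ w‖ ^ 2 else 0)
      ≤ ∑ w ∈ S, ∑ μ : Fin (F.P K).d, ‖(frobEquiv.symm (X ⟨transl c w, μ⟩) : W₂)‖ ^ 2 := by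
        refine Finset.sum_le_sum fun w hw => Finset.sum_le_sum fun μ _ => ?_
        split_ifs with hμ
        · rw [← hD w (hS hw) μ (hS hμ)]
          exact pow_le_pow_left₀ (norm_nonneg _) (norm_le_norm_frobEquiv_symm _) 2
        · positivity
    _ = ∑ x ∈ S.image (transl c), ∑ μ : Fin (F.P K).d, ‖(frobEquiv.symm (X ⟨x, μ⟩) : W₂)‖ ^ 2 := by rw [Finset.sum_image hinj]
    _ ≤ ∑ x, ∑ μ : Fin (F.P K).d, ‖(frobEquiv.symm (X ⟨x, μ⟩) : W₂)‖ ^ 2 :=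
        Finset.sum_le_sum_of_subset_of_nonneg (Finset.subset_univ _) fun x _ _ => by positivity

end Summit.QuantumFields.YangMills.Theorems.Prop7TiledCubeMemberRows

end
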